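import Literature.IUT.HodgeTheaters.PuncturedEllipticArrowModelGalois
import HarnessLib

/-!
# The finite model of [IUTchI] §1 with the zero cusp UNRAMIFIED in `X̲→ → X̲` — independence of the `ε⁰`-clause (definitions + kernel)

Mochizuki, *Inter-universal Teichmüller theory I*, kurims manuscript (May 2020), §1 pp. 37–39
([IUTchI] §1 p.39) [claim: Mochizuki2012, status: disputed] (D-0012 claim key; series status DISPUTED —
WITNESS-class module, pure finite group theory over abc-iut-L5-t1's model files
`PuncturedEllipticArrowModel*.lean`; nothing of the series is asserted, no side is taken on [IUTchIII]
Cor. 3.12).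

PURPOSE (abc-iut-L5-t1 lineage, owner of the §1 interface `PuncturedEllipticData`; the «t1 reading» asked
for by GAP-LEDGER row G-L5d4g6-1).  The proof of [IUTchI] Cor. 1.2 (p. 39) uses the clause «the
decomposition groups of `ε⁰, ε′, ε″` … whose image in `Gal(X̲→/X̲) = Π_X̲/Π_{X̲→}` is nontrivial»; for
`ε′, ε″` this is a kernel consequence of the frozen `ArrowCoveringClaims` (abc-iut-L5-d4,
`ArrowCoveringClaims.not_inertia_le_piXarrow_iff`), for `ε⁰` it enters abc-iut-L5-d4's assembly
`characteristicNatureOfCoverings_of_anabelian` as the binder `h0 : ¬ D.inertia D.ε0 ≤ D.piXarrow`.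
THIS FILE and its sequel `PuncturedEllipticArrowModelUnorientedDatum.lean` certify in the kernel that
`h0` is INDEPENDENT of every typed §1 predicate jointly (`ArrowCoveringClaims`, `Rmk121`,
`ArrowOpenClaims`, the companion `CuspGalois`, hypothesis (∗), the Def. 3.1 (d) numerics): in the model
`Π_C = N ⋊ D_l` of `PuncturedEllipticArrowModel.lean` (`N = Δ_X̲^{ab} ⊗ ℤ/l = (ℤ/l)·A ⊕ ⨁_i (ℤ/l)·B_i`)
we REPLACE the inertia vectors `c_i = B_{i+1} − B_i` (which satisfy the surface relation `Σ_i c_i = 0`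
and `ι̲(c_0) = c_0`) by
  `c′_i := B_i + B_{i+1}`
(label: UNORIENTED variant — `ι̲ = σ_0` now acts on the inertia line of `ε⁰` by `−1`, `σ_0(c′_0) = −c′_0`,
the «orientation-reversing» behaviour that the cyclotomic rigidity of inertia groups of an actual curve
forbids, and `Σ_i c′_i = 2·Σ_j B_j ≠ 0`).  Everything the typed predicates see is UNCHANGED: the
`Δ_ε⁺`-coordinate is the same `ℓ(A, f) = f(0) − f(1)` (`ℓ(c′_i) = [i = −1] − [i = 1]`), the kernel
`jKer` is the same `K = {f(0) = f(1)}` (this file: `supU_closure_commSet_eq_Khat` — `K` is still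
generated by the allowed inertia `c′_2, …, c′_{l−2}` and the `(−1)`-eigenspace: `B_j ≡ ±B_2` by
ALTERNATING telescoping, `2B_2 = (B_2 + B_{−1}) + (B_2 − B_{−1})`), hence the same `Π_{X̲→} = K`,
`Π_{C̲→} = K′`, indices, cyclic quotients, normalisers and cusp action — but now
  `c′_0 ∈ K`, i.e. `I_{ε⁰} ⊆ Π_{X̲→}`: the zero cusp is UNRAMIFIED in `X̲→ → X̲`,
whereas in the genuine model `ℓ(c_0) = −2 ≠ 0`.  So both `h0` and `¬ h0` are consistent with the typed
record; the print input that decides it is «the product of cyclotomically oriented cusp-inertia generators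
of `Δ_X̲` is a commutator» together with «`ι̲` respects the orientation of `I_{ε⁰}`» — étale-π₁-of-curves
structure (INTERFACE, TODO-merge abc-iut-L4-t1), not an [IUTchI] claim.
Here (part 1): `uvec/uhat/Du/EpsSupU`, the action `φ_d(c′_i) = ±c′_{d·i}`, `ℓ(c′_i)`, `D′_0 ≤ K`, and the
kernel computation.  No instance, no `sorry`, symbolic `l`; axioms standard.
-/

namespace Literature.IUT.HodgeTheaters

namespace PuncturedEllipticData

namespace ArrowModel

open DihedralGroup
open scoped Pointwise

variable (l : ℕ)

/-! ### The unoriented inertia vectors `c′_i := B_i + B_{i+1}` -/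

/-- The UNORIENTED inertia vector of the cusp `i`: `c′_i := B_i + B_{i+1}` (contrast `c_i = B_{i+1} − B_i`).
([IUTchI] §1 p.37) [claim: Mochizuki2012, status: disputed] -/
def uvec (i : ZMod l) : V l := (0, δ l i + δ l (i + 1))

/-- `rot k (c′_i) = c′_{i+k}`. [claim: Mochizuki2012, status: disputed] -/
theorem rot_uvec (k i : ZMod l) : rot l k (uvec l i) = uvec l (i + k) := by
  simp only [uvec, rot_apply, Prod.mk.injEq, true_and]
  funext m
  simp only [Pi.add_apply, δ_apply]
  have h1 : (m - k = i + 1) ↔ (m = i + k + 1) :=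
    ⟨fun h => by linear_combination h, fun h => by linear_combination h⟩
  have h2 : (m - k = i) ↔ (m = i + k) :=
    ⟨fun h => by linear_combination h, fun h => by linear_combination h⟩
  simp only [h1, h2]

/-- `σ_k (c′_i) = −c′_{−k−i}`: the reflections REVERSE the unoriented inertia vectors (this sign is the whole
point of the variant: `σ_0(c′_0) = −c′_0`). [claim: Mochizuki2012, status: disputed] -/
theorem refl_uvec (k i : ZMod l) : refl l k (uvec l i) = -uvec l (-k - i) := by
  simp only [uvec, refl_apply, neg_zero, Prod.neg_mk, Prod.mk.injEq, true_and]
  funext m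
  simp only [Pi.add_apply, Pi.neg_apply, δ_apply]
  have h1 : (1 - k - m = i + 1) ↔ (m = -k - i) :=
    ⟨fun h => by linear_combination -h, fun h => by linear_combination -h⟩
  have h2 : (1 - k - m = i) ↔ (m = -k - i + 1) :=
    ⟨fun h => by linear_combination -h, fun h => by linear_combination -h⟩
  simp only [h1, h2]
  ring

/-- `φ_d(c′_i) = ± c′_{d·i}`: `+` for rotations, `−` for reflections. [claim: Mochizuki2012, status: disputed] -/
theorem dact_uvec (d : DihedralGroup l) (i : ZMod l) :
    dact l d (uvec l i) = uvec l (cuspAct l d i) ∨ dact l d (uvec l i) = -uvec l (cuspAct l d i) := by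
  cases d with
  | r k => left; rw [dact_r, rot_uvec, cuspAct_r]
  | sr k => right; rw [dact_sr, refl_uvec, cuspAct_sr]

/-- The unoriented inertia element `ĉ′_i := (c′_i, 1) ∈ N ⊆ Π_C`. [claim: Mochizuki2012, status: disputed] -/
def uhat (i : ZMod l) : G l := inN l (uvec l i)

/-- The decomposition (= inertia, `G_k = 1`) group of the cusp `i` in the unoriented variant: `D′_i := ⟨ĉ′_i⟩`.
[claim: Mochizuki2012, status: disputed] -/
def Du (i : ZMod l) : Subgroup (G l) := Subgroup.zpowers (uhat l i)

/-- `g ĉ′_i g⁻¹ = (ĉ′_{g·i})^{±1}`. [claim: Mochizuki2012, status: disputed] -/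
theorem conj_uhat (g : G l) (i : ZMod l) :
    g * uhat l i * g⁻¹ = uhat l (cuspAct l g.right i) ∨
      g * uhat l i * g⁻¹ = (uhat l (cuspAct l g.right i))⁻¹ := by
  unfold uhat
  rw [conj_inN]
  rcases dact_uvec l g.right i with h | h
  · exact Or.inl (by rw [h])
  · exact Or.inr (by rw [h, inN_neg])

/-- `g D′_i g⁻¹ = D′_{g·i}` EXACTLY (a cyclic group is generated by the inverse of a generator as well).
([IUTchI] §1 p.37) [claim: Mochizuki2012, status: disputed] -/
theorem conj_smul_Du (g : G l) (i : ZMod l) :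
    MulAut.conj g • Du l i = Du l (cuspAct l g.right i) := by
  unfold Du
  rw [Subgroup.pointwise_smul_def, MonoidHom.map_zpowers]
  simp only [MulDistribMulAction.toMonoidEnd_apply, MulDistribMulAction.toMonoidHom_apply,
    MulAut.smul_def, MulAut.conj_apply]
  rcases conj_uhat l g i with h | h
  · rw [h]
  · rw [h, Subgroup.zpowers_inv]

/-- `D′_i ≤ N`. [claim: Mochizuki2012, status: disputed] -/
theorem Du_le_Nhat (i : ZMod l) : Du l i ≤ Nhat l := by
  unfold Du
  rw [Subgroup.zpowers_le]
  exact inN_mem_Nhat l _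

/-- `ℓ(c′_i)` in terms of `δ`'s. [claim: Mochizuki2012, status: disputed] -/
theorem ell_uvec (i : ZMod l) :
    ell l (uvec l i) = (δ l i 0 + δ l (i + 1) 0) - (δ l i 1 + δ l (i + 1) 1) := rfl

/-- **`ℓ(c′_i) = 0` for EVERY `i ∉ {1, −1}` — including `i = 0 = ε⁰`** (the `B_0`-contributions of `c′_0`
at `0` and of `c′_0` at `1` cancel). [claim: Mochizuki2012, status: disputed] -/
theorem ell_uvec_eq_zero {i : ZMod l} (h1 : i ≠ 1) (h2 : i ≠ -1) : ell l (uvec l i) = 0 := by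
  rw [ell_uvec]
  simp only [δ_apply]
  have e1 : ¬ (0 : ZMod l) = i + 1 := fun h => h2 (by linear_combination -h)
  have e4 : ¬ (1 : ZMod l) = i := fun h => h1 h.symm
  have e23 : ((1 : ZMod l) = i + 1) ↔ ((0 : ZMod l) = i) :=
    ⟨fun h => by linear_combination h, fun h => by linear_combination h⟩
  rw [if_neg e1, if_neg e4]
  simp only [e23]
  ring

/-- **`D′_i ≤ K` for every cusp `i ∉ {ε′, ε″} = {1, −1}`**, in particular for the ZERO CUSP `i = 0`.
([IUTchI] §1 p.39) [claim: Mochizuki2012, status: disputed] -/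
theorem Du_le_Khat {i : ZMod l} (h1 : i ≠ 1) (h2 : i ≠ -1) : Du l i ≤ Khat l := by
  unfold Du uhat
  rw [Subgroup.zpowers_le, inN_mem_Khat_iff]
  exact ell_uvec_eq_zero l h1 h2

/-- **`D′_0 ≤ K`**: the zero cusp's inertia dies in `Δ_ε⁺` in the unoriented variant (for `3 ≤ l`, so that
`0 ≠ ±1`). ([IUTchI] §1 p.39) [claim: Mochizuki2012, status: disputed] -/
theorem Du_zero_le_Khat (h3 : 3 ≤ l) : Du l 0 ≤ Khat l := by
  have h10 : (1 : ZMod l) ≠ 0 := by exact_mod_cast natCast_ne_zero_of_lt l (a := 1) one_pos (by omega)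
  exact Du_le_Khat l h10.symm (fun h => h10 (by linear_combination h))

/-- `⨆ D′_x` over the nonzero cusps `x ≠ ε′, ε″`, i.e. `x ∉ {0, 1, −1}`. [claim: Mochizuki2012, status: disputed] -/
def EpsSupU : Subgroup (G l) := ⨆ x : {x : ZMod l // x ≠ 0 ∧ x ≠ 1 ∧ x ≠ -1}, Du l x.1

/-- `⨆_{x ∉ {0, ±1}} D′_x ≤ K`. [claim: Mochizuki2012, status: disputed] -/
theorem EpsSupU_le_Khat : EpsSupU l ≤ Khat l :=
  iSup_le fun x => Du_le_Khat l x.2.2.1 x.2.2.2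

/-! ### `K` is still generated by the allowed inertia and the commutators -/

/-- The `A`-direction is a commutator: `(A, 0) ∈ ⟨x c x⁻¹ c⁻¹⟩` (`l = 2q + 1`). ([IUTchI] §1 p.38)
[claim: Mochizuki2012, status: disputed] -/
theorem inN_fst_mem_closure_commSet {q : ℕ} (hq : l = 2 * q + 1) (A : ZMod l) :
    inN l (A, 0) ∈ Subgroup.closure (commSet l) := by
  have h2 : (2 * (q + 1 : ℕ) : ZMod l) = 1 := by
    have : ((2 * (q + 1) : ℕ) : ZMod l) = ((l + 1 : ℕ) : ZMod l) := by rw [hq]; ring_nf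
    rw [← Nat.cast_ofNat, ← Nat.cast_mul, this, Nat.cast_succ, ZMod.natCast_self, zero_add]
  have key : ((A, 0) : V l) = ((q + 1 : ℕ) * A, 0) - refl l 0 ((q + 1 : ℕ) * A, 0) := by
    ext m
    · simp only [refl_apply, Prod.fst_sub, sub_neg_eq_add]
      linear_combination -A * h2
    · simp only [refl_apply, Prod.snd_sub, Pi.sub_apply, Pi.zero_apply, neg_zero, sub_zero]
  rw [key]
  exact Subgroup.subset_closure (inN_sub_refl_mem_commSet l _)

/-- `B_j + B_{1−j}` is a commutator: `(0, δ_j + δ_{1−j}) ∈ ⟨x c x⁻¹ c⁻¹⟩`. ([IUTchI] §1 p.38)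
[claim: Mochizuki2012, status: disputed] -/
theorem inN_δ_add_δ_mem_closure_commSet (j : ZMod l) :
    inN l (0, δ l j + δ l (1 - j)) ∈ Subgroup.closure (commSet l) := by
  have key : ((0, δ l j + δ l (1 - j)) : V l) = (0, δ l j) - refl l 0 (0, δ l j) := by
    ext m
    · simp
    · simp only [refl_apply, Prod.snd_sub, Pi.add_apply, Pi.sub_apply, sub_neg_eq_add, δ_apply, sub_zero]
      have h : (1 - m = j) ↔ (m = 1 - j) :=
        ⟨fun h => by linear_combination -h, fun h => by linear_combination -h⟩
      simp only [h]
  rw [key]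
  exact Subgroup.subset_closure (inN_sub_refl_mem_commSet l _)

/-- `ĉ′_{n+2} ∈ ⨆_{x ∉ {0,±1}} D′_x` for `n + 3 < l`... precisely for `0 < n + 2 < l − 1`. [claim: Mochizuki2012, status: disputed] -/
theorem uhat_mem_EpsSupU (n : ℕ) (hn : n + 3 < l) : uhat l ((n + 2 : ℕ) : ZMod l) ∈ EpsSupU l := by
  have h0 : ((n + 2 : ℕ) : ZMod l) ≠ 0 := natCast_ne_zero_of_lt l (by omega) (by omega)
  have h1 : ((n + 2 : ℕ) : ZMod l) ≠ 1 := by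
    intro h
    rw [← Nat.cast_one] at h
    exact absurd (natCast_injOn l (by omega) (by omega) h) (by omega)
  have h2 : ((n + 2 : ℕ) : ZMod l) ≠ -1 := by
    intro h
    have h' : ((n + 3 : ℕ) : ZMod l) = 0 := by push_cast at h ⊢; linear_combination h
    exact natCast_ne_zero_of_lt l (by omega) hn h'
  have hle : Du l ((n + 2 : ℕ) : ZMod l) ≤ EpsSupU l :=
    le_iSup (fun x : {x : ZMod l // x ≠ 0 ∧ x ≠ 1 ∧ x ≠ -1} => Du l x.1) ⟨_, h0, h1, h2⟩
  exact hle (Subgroup.mem_zpowers _)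

/-- ALTERNATING telescoping: `δ_{n+2} − (−1)^n δ_2 = c′_{n+1} − c′_n + ⋯ ± c′_2 ∈ ⨆_{x ∉ {0,±1}} D′_x`
(`n + 2 < l`). ([IUTchI] §1 p.37) [claim: Mochizuki2012, status: disputed] -/
theorem inN_δ_sub_pow_δ_two_mem_EpsSupU :
    ∀ n : ℕ, n + 2 < l →
      inN l ((0, δ l ((n + 2 : ℕ) : ZMod l)) - ((-1 : ℤ) ^ n) • ((0, δ l 2) : V l)) ∈ EpsSupU l := by
  intro n
  induction n with
  | zero =>
    intro _
    rw [pow_zero, one_zsmul, Nat.zero_add, Nat.cast_ofNat, sub_self, inN_zero]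
    exact (EpsSupU l).one_mem
  | succ n ih =>
    intro hn
    have hmem := ih (by omega)
    -- `δ_{n+3} − (−1)^{n+1} δ_2 = c′_{n+2} − (δ_{n+2} − (−1)^n δ_2)`
    have key : ((0, δ l ((n + 1 + 2 : ℕ) : ZMod l)) : V l) - ((-1 : ℤ) ^ (n + 1)) • ((0, δ l 2) : V l) =
        uvec l ((n + 2 : ℕ) : ZMod l) -
          (((0, δ l ((n + 2 : ℕ) : ZMod l)) : V l) - ((-1 : ℤ) ^ n) • ((0, δ l 2) : V l)) := by
      ext m
      · simp [uvec]
      · simp only [uvec, Prod.snd_sub, Prod.smul_snd, Pi.add_apply, Pi.sub_apply, Pi.smul_apply]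
        simp only [zsmul_eq_mul, Int.cast_pow, Int.cast_neg, Int.cast_one]
        rw [show ((n + 1 + 2 : ℕ) : ZMod l) = ((n + 2 : ℕ) : ZMod l) + 1 by push_cast; ring]
        ring
    rw [key, sub_eq_add_neg, inN_add, inN_neg]
    exact (EpsSupU l).mul_mem (uhat_mem_EpsSupU l n hn) ((EpsSupU l).inv_mem hmem)

/-- `δ_{−1} − δ_2 ∈ ⨆_{x ∉ {0,±1}} D′_x` (`l = 2q + 1 ≥ 3`: the case `n = l − 3`, even, of the telescope).
[claim: Mochizuki2012, status: disputed] -/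
theorem inN_δ_neg_one_sub_δ_two_mem_EpsSupU {q : ℕ} (hq : l = 2 * q + 1) (h3 : 3 ≤ l) :
    inN l (0, δ l (-1) - δ l 2) ∈ EpsSupU l := by
  have h := inN_δ_sub_pow_δ_two_mem_EpsSupU l (l - 3) (by omega)
  have hev : Even (l - 3) := ⟨q - 1, by omega⟩
  have hcast : ((l - 3 + 2 : ℕ) : ZMod l) = -1 := by
    rw [show l - 3 + 2 = l - 1 by omega, Nat.cast_sub (by omega), ZMod.natCast_self, Nat.cast_one,
      zero_sub]
  rw [hev.neg_one_pow, one_zsmul, hcast] at h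
  have e : ((0, δ l (-1) - δ l 2) : V l) = ((0, δ l (-1)) : V l) - (0, δ l 2) := by ext m <;> simp
  rw [e]; exact h

/-- `(0, δ_2) ∈ ⨆ D′_x ⊔ ⟨commutators⟩` (`2δ_2 = (δ_2 + δ_{−1}) + (δ_2 − δ_{−1})`, `2` invertible).
([IUTchI] §1 p.38) [claim: Mochizuki2012, status: disputed] -/
theorem inN_δ_two_mem_supU {q : ℕ} (hq : l = 2 * q + 1) (h3 : 3 ≤ l) :
    inN l (0, δ l 2) ∈ EpsSupU l ⊔ Subgroup.closure (commSet l) := by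
  have htwo : inN l ((2 : ℕ) • ((0, δ l 2) : V l)) ∈ EpsSupU l ⊔ Subgroup.closure (commSet l) := by
    have e : ((2 : ℕ) • (0, δ l 2) : V l) = (0, δ l 2 + δ l (1 - 2)) - (0, δ l (-1) - δ l 2) := by
      rw [show (1 : ZMod l) - 2 = -1 by ring]
      ext m
      · simp
      · simp only [two_nsmul, Prod.snd_sub, Prod.snd_add, Pi.add_apply, Pi.sub_apply]
        ring
    rw [e, sub_eq_add_neg, inN_add, inN_neg]
    exact Subgroup.mul_mem _ (Subgroup.mem_sup_right (inN_δ_add_δ_mem_closure_commSet l 2))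
      (Subgroup.mem_sup_left ((EpsSupU l).inv_mem (inN_δ_neg_one_sub_δ_two_mem_EpsSupU l hq h3)))
  have e : ((0, δ l 2) : V l) = (q + 1) • ((2 : ℕ) • ((0, δ l 2) : V l)) := by
    rw [← mul_nsmul', show (q + 1) * 2 = l + 1 by omega, succ_l_nsmul]
  rw [e, inN_nsmul]
  exact Subgroup.pow_mem _ htwo _

/-- For `j ∉ {0, 1}`: `(0, δ_j) ∈ ⨆ D′_x ⊔ ⟨commutators⟩` (`δ_j = (δ_j ∓ δ_2) ± δ_2`). ([IUTchI] §1 p.38)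
[claim: Mochizuki2012, status: disputed] -/
theorem inN_δ_mem_supU [NeZero l] {q : ℕ} (hq : l = 2 * q + 1) (h3 : 3 ≤ l) {j : ZMod l}
    (hj0 : j ≠ 0) (hj1 : j ≠ 1) : inN l (0, δ l j) ∈ EpsSupU l ⊔ Subgroup.closure (commSet l) := by
  have hv0 : j.val ≠ 0 := fun h => hj0 ((ZMod.val_eq_zero j).mp h)
  have hv1 : j.val ≠ 1 := by
    intro h
    apply hj1
    have := ZMod.natCast_zmod_val j
    rw [h, Nat.cast_one] at this
    exact this.symm
  have hlt := ZMod.val_lt j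
  obtain ⟨n, hn⟩ : ∃ n : ℕ, j.val = n + 2 := ⟨j.val - 2, by omega⟩
  have hmem := inN_δ_sub_pow_δ_two_mem_EpsSupU l n (by omega)
  rw [← hn, ZMod.natCast_zmod_val] at hmem
  have e : ((0, δ l j) : V l) =
      (((0, δ l j) : V l) - ((-1 : ℤ) ^ n) • ((0, δ l 2) : V l)) + ((-1 : ℤ) ^ n) • ((0, δ l 2) : V l) := by
    rw [sub_add_cancel]
  rw [e, inN_add, inN_zsmul]
  exact Subgroup.mul_mem _ (Subgroup.mem_sup_left hmem) (Subgroup.zpow_mem _ (inN_δ_two_mem_supU l hq h3) _)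

/-- **`K ≤ ⨆_{x ∉ {0,±1}} D′_x ⊔ ⟨commutators⟩`** in the unoriented variant. ([IUTchI] §1 p.38)
[claim: Mochizuki2012, status: disputed] -/
theorem Khat_le_supU [NeZero l] {q : ℕ} (hq : l = 2 * q + 1) (h3 : 3 ≤ l) :
    Khat l ≤ EpsSupU l ⊔ Subgroup.closure (commSet l) := by
  intro g hg
  obtain ⟨hg1, hg2⟩ := hg
  set S := EpsSupU l ⊔ Subgroup.closure (commSet l) with hS
  rw [eq_inN_of_right_eq_one l hg1]
  set v := Multiplicative.toAdd g.left with hv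
  have hℓ : v.2 0 = v.2 1 := sub_eq_zero.mp hg2
  have e1 : v = (v.1, 0) + (0, v.2) := by ext <;> simp
  rw [e1, inN_add]
  refine S.mul_mem (Subgroup.mem_sup_right (inN_fst_mem_closure_commSet l hq v.1)) ?_
  have hne : (1 : ZMod l) ≠ 0 := by
    haveI : Fact (1 < l) := ⟨by omega⟩
    exact one_ne_zero
  have e2 : ((0, v.2) : V l) = ∑ j, ((0, Pi.single j (v.2 j)) : V l) := by
    ext m
    · rw [Prod.fst_sum]; simp
    · rw [Prod.snd_sum]
      simp only
      rw [Finset.sum_apply, ← congrFun (Finset.univ_sum_single v.2) m, Finset.sum_apply]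
  have h1mem : (1 : ZMod l) ∈ Finset.univ.erase (0 : ZMod l) := Finset.mem_erase.mpr ⟨hne, Finset.mem_univ _⟩
  rw [e2, ← Finset.add_sum_erase _ _ (Finset.mem_univ (0 : ZMod l)), ← Finset.add_sum_erase _ _ h1mem,
    ← add_assoc, inN_add]
  refine S.mul_mem ?_ ?_
  · have e3 : ((0, Pi.single (0 : ZMod l) (v.2 0)) : V l) + (0, Pi.single (1 : ZMod l) (v.2 1)) =
        (v.2 0).val • ((0, δ l 0 + δ l (1 - 0)) : V l) := by
      rw [← hℓ, sub_zero]
      ext m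
      · simp
      · simp only [Prod.snd_add, Pi.add_apply, Prod.smul_snd, Pi.smul_apply, single_eq_nsmul_δ, smul_add]
    rw [e3, inN_nsmul]
    exact S.pow_mem (Subgroup.mem_sup_right (inN_δ_add_δ_mem_closure_commSet l 0)) _
  · refine inN_sum_mem l S _ _ fun j hj => ?_
    rw [Finset.mem_erase, Finset.mem_erase] at hj
    obtain ⟨hj1, hj0, -⟩ := hj
    have e4 : ((0, Pi.single j (v.2 j)) : V l) = (v.2 j).val • ((0, δ l j) : V l) := by
      ext m
      · simp
      · simp only [Prod.smul_snd, single_eq_nsmul_δ]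
    rw [e4, inN_nsmul]
    exact S.pow_mem (inN_δ_mem_supU l hq h3 hj0 hj1) _

/-- **`jKer` of the unoriented variant is the SAME `K`**: `(⨆_{x ∉ {0,±1}} D′_x) ⊔ ⟨x c x⁻¹ c⁻¹⟩ = K`.
([IUTchI] §1 p.38) [claim: Mochizuki2012, status: disputed] -/
theorem supU_closure_commSet_eq_Khat [NeZero l] {q : ℕ} (hq : l = 2 * q + 1) (h3 : 3 ≤ l) :
    EpsSupU l ⊔ Subgroup.closure (commSet l) = Khat l :=
  le_antisymm (sup_le (EpsSupU_le_Khat l) (closure_commSet_le_Khat l)) (Khat_le_supU l hq h3)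

end ArrowModel

end PuncturedEllipticData

end Literature.IUT.HodgeTheaters
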